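import Summits.ABC.ABC.Theses.DefiniteXi
import Summits.ABC.ABC.Theorems.DefiniteXiPolyFreyDegreeValuation
import HarnessLib

/-!
# Route DefiniteXi — item `PolyFreyDegree` (stmt-ABC-2026): the weak rung, its reductions, and why it stays open

Item `Summit.ABC.ABC.Theses.DefiniteXi.PolyFreyDegree` (support, rank 9, route `DefiniteXi`):
absolute `A, C` with, for all coprime `a, b` (`ab(a+b) ≠ 0`) and `N` the conductor of the Frey curve
`E_{a,b} : y² = x(x − a)(x + b)`, SOME modular parametrisation datum `D` of `E_{a,b}` at level `N`
with `deg D ≤ C · N^A` — the polynomial modular-degree conjecture on Frey curves ("polynomial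
Szpiro in disguise", route docstring).

## Status of the item (prover analysis, 2026-08-16): OPEN both ways in the tree

* **Not provable.** `ModularParametrizationData W N` (`Literature/…/ModularCurve.lean`) is an honest
  hypothesis structure: `f` is a genuine `CuspForm (Γ₀(N)) 2` with `IsNewformOf W f`
  (`IsNewform0 f ∧ aₙ(f) = aₙ(W)`, so `a₁(f) = 1`, `f ≠ 0`), `uniformize : ℂ →+ E(ℂ)` is onto with
  kernel the lattice, and `deg` is pinned by `deg_spec`; `c = 0` or a constant `φ` contradict
  `deg_spec` (`E(ℂ)` is infinite).  So inhabiting the type for a single Frey curve is modularity of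
  that curve in datum form — the route's own item `FreyModularity` (stmt-ABC-11340, Wiles/BCDT, XL);
  `freyModularity_of_polyFreyDegree` below records `PolyFreyDegree → FreyModularity`.  On top of
  existence the degree bound is an open conjecture (⟺ polynomial abc on Frey curves: Frey 1997
  Cor. 3.1; Murty 1999 Thm 1; nothing polynomial is known — Murty–Pasten 2013, Pasten 2024).
* **Not refutable.** No emptiness artefact (integral non-minimal Frey models carry data with integer
  Manin constant `m · c₀`), and `¬ PolyFreyDegree` would be the failure of polynomial abc.

## What this file proves (complete proofs; the conditional results name their facts)

* (A) `polyFreyDegree_of_freyDegreeBound` — the thesis `FreyDegreeBound` (stmt-ABC-2019) gives the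
  weak rung with `A = 3` ("trivially implied by FreyDegreeBound", item docstring).
* (B) `minimalDegreeBound_of_xiBound_of_valuationBound` (no modularity input) and
  `polyFreyDegree_of_xiBound_of_valuationBound` — **the weak glue**: `XiBound` (stmt-ABC-11336)
  `→ DefiniteRTControlPrime` (stmt-ABC-11338) `→` (a polynomial bound `v_q(Δ_min) ≤ K N^B` at odd
  primes `q ∣ N`) `→` polynomial bound for minimal-degree data `→` (with `FreyModularity`,
  stmt-ABC-11340, via (E)) `PolyFreyDegree`.  Same plan as the landed
  `definiteGlue_holds` (`Theorems/RibetTakahashiSplitWeightedSzpiroBoundForgivenDegreeBoundOfDefiniteXi`,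
  whose private helpers `deg_le_sInf`, `prime_eq_two_of_dvd`, `natAbs_le_two` are re-proved here):
  `N⁻ :=` one odd prime `q ∣ N`; if `N` is a power of two then `rad|ab(a+b)| ∣ 2N` forces
  `|a|, |b| ≤ 2` and the finitely many minimal degrees are absorbed into `C`; a minimal-degree datum
  exists by `FreyModularity` + well-ordering (`exists_minimal_datum`).
* (C) `freyValuationBound_of_stewartTijdeman` (companion file
  `DefiniteXiPolyFreyDegreeValuation.lean`, imported) — the valuation input from the named fact
  `Literature.Barriers.ABC.stewartTijdeman1986_upperBound` (`log c ≤ κ rad(abc)^{15}`, Stewart–Tijdeman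
  1986; implied by Stewart–Yu 2001 = `stewart_yu`, abc.S06): `v_q(Δ_min(E_{a,b})) ≤ K N^{15}` for odd
  `q`, via `v_q(Δ_min) ≤ 2 v_q(ab(a+b))` (the model (12.17) is minimal at odd `q`,
  `factorization_minimalDiscriminantNorm_freyCurve_le`), `2^v ≤ |ab(a+b)|`,
  `log|ab(a+b)| ≤ 3κ rad^{15}` (`log_natAbs_le_of_stewartTijdeman`, signs rearranged into an abc
  triple) and `rad|ab(a+b)| ≤ 2N`.
* (E) `polyFreyDegree_iff_freyModularity_and_minimalBound` — the weak rung splits as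
  `FreyModularity ∧` (polynomial bound for MINIMAL-degree data), the `∃ A C`-analogue of
  `MinimalBoundGivesTarget` (stmt-ABC-3328).
* (D) `polyFreyDegree_of_xiBound`, `polyFreyDegree_of_xiBound_of_stewartYu` — the item docstring's
  claim "XiBound ∧ DefiniteRTControl ∧ (v_q(Δ) ≤ N^16, Stewart–Tijdeman) ⟹ PolyFreyDegree" made
  formal, CONDITIONAL on the transcendence fact only (plus the three route items as hypotheses).

So the item is exactly as hard as `XiBound` + `FreyModularity` given known facts, and at least as
hard as `FreyModularity` alone; it is not closed by this file.

## References

* G. Frey, *On ternary equations of Fermat type and relations with elliptic curves*, in Modular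
  Forms and Fermat's Last Theorem (1997), Cor. 3.1.
* M. R. Murty, *Bounds for congruence primes*, Proc. Sympos. Pure Math. 66.1 (1999), Thm 1.
* C. L. Stewart, R. Tijdeman, *On the Oesterlé–Masser conjecture*, Monatsh. Math. 102 (1986);
  C. L. Stewart, K. Yu, Duke Math. J. 108 (2001), Thm 1.
* S. Takahashi, J. Number Theory 90 (2001), Thm 2.3/3.8; H. Pasten, arXiv:1705.09251, Thm 6.1.
* E. Bombieri, W. Gubler, *Heights in Diophantine Geometry* (2006), Ex. 12.5.10.
-/

-- Summit.<Summit>.<Problem> is the mandated namespace; for the single-conjunct summit ABC the duplicate ABC.ABC is deliberate.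
set_option linter.dupNamespace false

noncomputable section

namespace Summit.ABC.ABC.Theorems.DefiniteXiPolyFreyDegree

open Literature.NumberTheory
open Literature.NumberTheory.EllipticCurves
open Literature.NumberTheory.EllipticCurves.ModularForms
open Literature.NumberTheory.DiophantineGeometry
open Summit.ABC.ABC.Theses.DefiniteXi
open UniqueFactorizationMonoid

/-! ## (A) The weak rung from the thesis `FreyDegreeBound` -/

/-- **(A) `FreyDegreeBound → PolyFreyDegree`**: the thesis of the route (Frey's degree conjecture
`deg ≤ C_ε N^{2+ε}` on Frey curves, stmt-ABC-2019) gives the weak rung with `A = 3` (`ε := 1`).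
[folklore] -/
theorem polyFreyDegree_of_freyDegreeBound (h : FreyDegreeBound) : PolyFreyDegree := by
  unfold PolyFreyDegree
  obtain ⟨C, hC⟩ := h 1 one_pos
  exact ⟨2 + 1, C, hC⟩

/-- **`PolyFreyDegree → FreyModularity`**: the weak rung contains the existence half (modularity of
Frey curves in datum form, stmt-ABC-11340) — whoever proves the item has in particular inhabited
`ModularParametrizationData (freyCurve a b) N` for every Frey curve. [folklore] -/
theorem freyModularity_of_polyFreyDegree (h : PolyFreyDegree) : FreyModularity := by
  intro a b hab h0 N _ hN
  obtain ⟨A, C, hAC⟩ := h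
  obtain ⟨D, -⟩ := hAC a b hab h0 N hN
  exact ⟨D⟩

/-! ## (B) The weak glue: helpers -/

/-- A nonempty type of parametrisation data has a datum of least degree (well-ordering of `ℕ`,
`Nat.find` on the set of degrees). [folklore] -/
theorem exists_minimal_datum {W : WeierstrassCurve ℚ} {N : ℕ} [NeZero N]
    (h : Nonempty (ModularParametrizationData W N)) :
    ∃ D : ModularParametrizationData W N, ∀ D' : ModularParametrizationData W N, D.deg ≤ D'.deg := by
  classical
  obtain ⟨D₀⟩ := h
  have hex : ∃ d : ℕ, ∃ D : ModularParametrizationData W N, D.deg = d := ⟨_, D₀, rfl⟩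
  obtain ⟨D, hD⟩ := Nat.find_spec hex
  refine ⟨D, fun D' => ?_⟩
  rw [hD]
  exact Nat.find_min' hex ⟨D', rfl⟩

/-- A minimal-degree datum at the conductor level has degree `≤` the infimum of all degrees of data
of that curve at its conductor level (in fact `=`; the infimum is a function of the pair `(a, b)`
alone).  Re-proof of the private lemma of the same name in
`Theorems/RibetTakahashiSplitWeightedSzpiroBoundForgivenDegreeBoundOfDefiniteXi.lean`. [folklore] -/
theorem deg_le_sInf {a b : ℤ} {N : ℕ} [NeZero N]
    (hN : (freyCurve a b).conductorNorm ℤ = N) (D : ModularParametrizationData (freyCurve a b) N)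
    (hmin : ∀ D' : ModularParametrizationData (freyCurve a b) N, D.deg ≤ D'.deg) :
    D.deg ≤ sInf {d : ℕ | ∃ (M : ℕ) (_ : NeZero M), (freyCurve a b).conductorNorm ℤ = M ∧
      ∃ D₀ : ModularParametrizationData (freyCurve a b) M, D₀.deg = d} := by
  have hmem : D.deg ∈ {d : ℕ | ∃ (M : ℕ) (_ : NeZero M), (freyCurve a b).conductorNorm ℤ = M ∧
      ∃ D₀ : ModularParametrizationData (freyCurve a b) M, D₀.deg = d} := ⟨N, ‹_›, hN, D, rfl⟩
  obtain ⟨N', _, hN', D', hD'⟩ := Nat.sInf_mem ⟨_, hmem⟩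
  obtain rfl : N' = N := hN'.symm.trans hN
  exact (hmin D').trans hD'.le

/-- If no odd prime divides the conductor `N` of `E_{a,b}` (`a, b` coprime, `ab(a+b) ≠ 0`), then
every prime factor of `ab(a+b)` is `2`, by `rad|ab(a+b)| ∣ 2N`
(`radical_natAbs_dvd_two_mul_conductorNorm_freyCurve`, Bombieri–Gubler Ex. 12.5.10).  Re-proof of
the private lemma of the same name in the `definiteGlue_holds` file. [folklore] -/
theorem prime_eq_two_of_dvd {a b : ℤ} (hab : IsCoprime a b) (h0 : a * b * (a + b) ≠ 0)
    {N : ℕ} [NeZero N] (hN : (freyCurve a b).conductorNorm ℤ = N)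
    (hno : ∀ q : ℕ, q.Prime → q ∣ N → q = 2) :
    ∀ p : ℕ, p.Prime → p ∣ (a * b * (a + b)).natAbs → p = 2 := by
  intro p hp hpd
  have hrad := radical_natAbs_dvd_two_mul_conductorNorm_freyCurve hab h0
  rw [hN] at hrad
  have h2N : 2 * N ≠ 0 := mul_ne_zero two_ne_zero (NeZero.ne N)
  have hm0 : (a * b * (a + b)).natAbs ≠ 0 := Int.natAbs_ne_zero.mpr h0
  have hsub := (Nat.radical_dvd_iff h2N).mp hrad
  have hp2N : p ∣ 2 * N :=
    Nat.dvd_of_mem_primeFactors (hsub (Nat.mem_primeFactors.mpr ⟨hp, hpd, hm0⟩))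
  rcases (Nat.Prime.dvd_mul hp).mp hp2N with h | h
  · exact (Nat.prime_dvd_prime_iff_eq hp Nat.prime_two).mp h
  · exact hno p hp h

/-- Coprime `a, b` all of whose prime factors of `ab(a+b)` are `2` satisfy `|a|, |b| ≤ 2`: an odd
divisor of `ab(a+b)` is `±1`, and `a, b` are not both even.  Re-proof of the private lemma of the
same name in the `definiteGlue_holds` file. [folklore] -/
theorem natAbs_le_two {a b : ℤ} (hab : IsCoprime a b)
    (h2 : ∀ p : ℕ, p.Prime → p ∣ (a * b * (a + b)).natAbs → p = 2) :
    a.natAbs ≤ 2 ∧ b.natAbs ≤ 2 := by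
  have key : ∀ x : ℤ, x ∣ a * b * (a + b) → ¬ (2 : ℤ) ∣ x → x.natAbs = 1 := by
    intro x hx hodd
    by_contra hne
    have hp := Nat.minFac_prime hne
    have hdvd : x.natAbs.minFac ∣ (a * b * (a + b)).natAbs :=
      (Nat.minFac_dvd _).trans (Int.natAbs_dvd_natAbs.mpr hx)
    have h2x : x.natAbs.minFac = 2 := h2 _ hp hdvd
    have h2x' : (2 : ℕ) ∣ x.natAbs := h2x ▸ Nat.minFac_dvd _
    exact hodd (by omega)
  have hnot : ¬ ((2 : ℤ) ∣ a ∧ (2 : ℤ) ∣ b) := by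
    rintro ⟨h2a, h2b⟩
    rcases Int.isUnit_iff.mp (hab.isUnit_of_dvd' h2a h2b) with h | h <;> omega
  have hda : a ∣ a * b * (a + b) := ⟨b * (a + b), by ring⟩
  have hdb : b ∣ a * b * (a + b) := ⟨a * (a + b), by ring⟩
  have hdab : (a + b) ∣ a * b * (a + b) := ⟨a * b, by ring⟩
  by_cases h2a : (2 : ℤ) ∣ a
  · have h2b : ¬ (2 : ℤ) ∣ b := fun h ↦ hnot ⟨h2a, h⟩
    have hb1 := key b hdb h2b
    have hab1 := key (a + b) hdab (by omega)
    omega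
  · have ha1 := key a hda h2a
    by_cases h2b : (2 : ℤ) ∣ b
    · have hab1 := key (a + b) hdab (by omega)
      omega
    · have hb1 := key b hdb h2b
      omega

/-! ## (B) The weak glue -/

/-- **(B₀) The weak glue for minimal data** (the `∃ A C`-analogue of `DefiniteGlue`, stmt-ABC-11341;
no modularity input).  `XiBound → DefiniteRTControlPrime → (v_q(Δ_min) ≤ K N^B at odd primes q ∣ N) →`
every MINIMAL-degree datum `D` of `E_{a,b}` at its conductor level satisfies `deg D ≤ C N^A`.
Proof: constants `A₁, C₁` (ξ-bound), `C₂` (`DefiniteRTControlPrime` at `ε := 1`), `B, K` (valuation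
bound), all clamped by `max · 0` (legitimate since `N ≥ 1` and `ξ`, `v_q` are cast naturals);
exponent `A := 1 + A₁⁺ + B⁺`, constant `C := C₂⁺ C₁⁺ K⁺ + Σ_{|a|,|b| ≤ 2} minDeg a b`.  If an odd
prime `q ∣ N`: `N⁻ := q` is admissible (odd, squarefree, one prime factor), so
`deg D ≤ C₂ N · ξ(N/q,q) · v_q(Δ_min) ≤ C₂⁺ C₁⁺ K⁺ N^A`.  If not, `|a|, |b| ≤ 2`
(`prime_eq_two_of_dvd`, `natAbs_le_two`) and `deg D ≤ minDeg a b` (`deg_le_sInf`) is absorbed by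
the finite sum. [folklore] -/
theorem minimalDegreeBound_of_xiBound_of_valuationBound (hXi : XiBound)
    (hRT : DefiniteRTControlPrime)
    (hval : ∃ B K : ℝ, ∀ a b : ℤ, IsCoprime a b → a * b * (a + b) ≠ 0 → ∀ (N : ℕ) [NeZero N],
      (freyCurve a b).conductorNorm ℤ = N → ∀ q : ℕ, q.Prime → q ≠ 2 → q ∣ N →
        ((((freyCurve a b).minimalDiscriminantNorm ℤ).factorization q : ℕ) : ℝ) ≤ K * (N : ℝ) ^ B) :
    ∃ A C : ℝ, ∀ a b : ℤ, IsCoprime a b → a * b * (a + b) ≠ 0 → ∀ (N : ℕ) [NeZero N],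
      (freyCurve a b).conductorNorm ℤ = N →
      ∀ D : ModularParametrizationData (freyCurve a b) N,
        (∀ D' : ModularParametrizationData (freyCurve a b) N, D.deg ≤ D'.deg) →
          (D.deg : ℝ) ≤ C * (N : ℝ) ^ A := by
  obtain ⟨A₁, C₁, hC₁⟩ := hXi
  obtain ⟨C₂, hC₂⟩ := hRT 1 one_pos
  obtain ⟨B, K, hK⟩ := hval
  -- the finitely many curves whose conductor is a power of two are absorbed here
  set minDeg : ℤ → ℤ → ℕ := (fun a b : ℤ ↦ sInf {d : ℕ | ∃ (M : ℕ) (_ : NeZero M),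
      (freyCurve a b).conductorNorm ℤ = M ∧
      ∃ D₀ : ModularParametrizationData (freyCurve a b) M, D₀.deg = d}) with hminDeg
  set Cfin : ℕ := ∑ a ∈ Finset.Icc (-2 : ℤ) 2, ∑ b ∈ Finset.Icc (-2 : ℤ) 2, minDeg a b with hCfin
  refine ⟨1 + max A₁ 0 + max B 0, max C₂ 0 * max C₁ 0 * max K 0 + (Cfin : ℝ),
    fun a b hab h0 N _ hN D hmin ↦ ?_⟩
  have hN1 : (1 : ℝ) ≤ (N : ℝ) := Nat.one_le_cast.mpr (Nat.one_le_iff_ne_zero.mpr (NeZero.ne N))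
  have hN0 : (0 : ℝ) ≤ (N : ℝ) := Nat.cast_nonneg N
  have hNpos : (0 : ℝ) < (N : ℝ) := one_pos.trans_le hN1
  have hA0 : (0 : ℝ) ≤ 1 + max A₁ 0 + max B 0 := by positivity
  have hNpow1 : (1 : ℝ) ≤ (N : ℝ) ^ (1 + max A₁ 0 + max B 0) := Real.one_le_rpow hN1 hA0
  have hNpow0 : (0 : ℝ) ≤ (N : ℝ) ^ (1 + max A₁ 0 + max B 0) := zero_le_one.trans hNpow1
  have hK0 : (0 : ℝ) ≤ max C₂ 0 * max C₁ 0 * max K 0 := by positivity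
  have hCfin0 : (0 : ℝ) ≤ (Cfin : ℝ) := Nat.cast_nonneg _
  by_cases hodd : ∃ q : ℕ, q.Prime ∧ q ≠ 2 ∧ q ∣ N
  · -- MAIN CASE: an odd prime `q ∣ N`; take `N⁻ := q`
    obtain ⟨q, hq, hq2, hqN⟩ := hodd
    have h1 := hC₂ a b hab h0 N hN q hq hq2 hqN D hmin
    have h2 := hC₁ a b hab h0 N hN q (hq.odd_of_ne_two hq2) hq.prime.squarefree
      (by rw [hq.primeFactors, Finset.card_singleton]; exact odd_one) hqN
    have h3 := hK a b hab h0 N hN q hq hq2 hqN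
    -- upgrade the three bounds to nonnegative constants and exponents
    set X : ℝ := (Literature.NumberTheory.Automorphic.brandtXi (N / q) q
      (fun n => (freyCurve a b).LFunction n) : ℝ) with hX
    set Y : ℝ := ((((freyCurve a b).minimalDiscriminantNorm ℤ).factorization q : ℕ) : ℝ) with hY
    have hX0 : 0 ≤ X := Nat.cast_nonneg _
    have hY0 : 0 ≤ Y := Nat.cast_nonneg _
    have hX' : X ≤ max C₁ 0 * (N : ℝ) ^ (max A₁ 0) :=
      calc X ≤ C₁ * (N : ℝ) ^ A₁ := h2
        _ ≤ max C₁ 0 * (N : ℝ) ^ A₁ :=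
          mul_le_mul_of_nonneg_right (le_max_left _ _) (Real.rpow_nonneg hN0 _)
        _ ≤ max C₁ 0 * (N : ℝ) ^ (max A₁ 0) :=
          mul_le_mul_of_nonneg_left (Real.rpow_le_rpow_of_exponent_le hN1 (le_max_left _ _))
            (le_max_right _ _)
    have hY' : Y ≤ max K 0 * (N : ℝ) ^ (max B 0) :=
      calc Y ≤ K * (N : ℝ) ^ B := h3
        _ ≤ max K 0 * (N : ℝ) ^ B :=
          mul_le_mul_of_nonneg_right (le_max_left _ _) (Real.rpow_nonneg hN0 _)
        _ ≤ max K 0 * (N : ℝ) ^ (max B 0) :=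
          mul_le_mul_of_nonneg_left (Real.rpow_le_rpow_of_exponent_le hN1 (le_max_left _ _))
            (le_max_right _ _)
    have hN1' : (N : ℝ) ^ (1 : ℝ) = N := Real.rpow_one _
    have hsplit : (N : ℝ) * (N : ℝ) ^ (max A₁ 0) * (N : ℝ) ^ (max B 0) =
        (N : ℝ) ^ (1 + max A₁ 0 + max B 0) := by
      rw [Real.rpow_add hNpos, Real.rpow_add hNpos, Real.rpow_one]
    calc (D.deg : ℝ) ≤ C₂ * (N : ℝ) ^ (1 : ℝ) * (X * Y) := h1
      _ = C₂ * N * (X * Y) := by rw [hN1']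
      _ ≤ max C₂ 0 * N * (X * Y) :=
          mul_le_mul_of_nonneg_right (mul_le_mul_of_nonneg_right (le_max_left _ _) hN0)
            (mul_nonneg hX0 hY0)
      _ ≤ max C₂ 0 * N * ((max C₁ 0 * (N : ℝ) ^ (max A₁ 0)) * (max K 0 * (N : ℝ) ^ (max B 0))) :=
          mul_le_mul_of_nonneg_left (mul_le_mul hX' hY' hY0 ((hX0.trans hX')))
            (mul_nonneg (le_max_right _ _) hN0)
      _ = max C₂ 0 * max C₁ 0 * max K 0 *
            ((N : ℝ) * (N : ℝ) ^ (max A₁ 0) * (N : ℝ) ^ (max B 0)) := by ring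
      _ = max C₂ 0 * max C₁ 0 * max K 0 * (N : ℝ) ^ (1 + max A₁ 0 + max B 0) := by rw [hsplit]
      _ ≤ (max C₂ 0 * max C₁ 0 * max K 0 + (Cfin : ℝ)) * (N : ℝ) ^ (1 + max A₁ 0 + max B 0) := by
          nlinarith
  · -- DEGENERATE CASE: `N` is a power of two; `|a|, |b| ≤ 2`
    push Not at hodd
    have hno : ∀ q : ℕ, q.Prime → q ∣ N → q = 2 := fun q hq hqN ↦ by
      by_contra hq2
      exact hodd q hq hq2 hqN
    obtain ⟨ha, hb⟩ := natAbs_le_two hab (prime_eq_two_of_dvd hab h0 hN hno)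
    have hdeg : D.deg ≤ minDeg a b := by rw [hminDeg]; exact deg_le_sInf hN D hmin
    have hmem_a : a ∈ Finset.Icc (-2 : ℤ) 2 := by rw [Finset.mem_Icc]; omega
    have hmem_b : b ∈ Finset.Icc (-2 : ℤ) 2 := by rw [Finset.mem_Icc]; omega
    have hfin : minDeg a b ≤ Cfin := by
      calc minDeg a b ≤ ∑ b' ∈ Finset.Icc (-2 : ℤ) 2, minDeg a b' :=
            Finset.single_le_sum (f := fun b' ↦ minDeg a b') (fun _ _ ↦ Nat.zero_le _) hmem_b
        _ ≤ Cfin :=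
            Finset.single_le_sum (f := fun a' ↦ ∑ b' ∈ Finset.Icc (-2 : ℤ) 2, minDeg a' b')
              (fun _ _ ↦ Nat.zero_le _) hmem_a
    have hdegR : (D.deg : ℝ) ≤ (Cfin : ℝ) := by exact_mod_cast hdeg.trans hfin
    calc (D.deg : ℝ) ≤ (Cfin : ℝ) := hdegR
      _ ≤ (Cfin : ℝ) * (N : ℝ) ^ (1 + max A₁ 0 + max B 0) := le_mul_of_one_le_right hCfin0 hNpow1
      _ ≤ (max C₂ 0 * max C₁ 0 * max K 0 + (Cfin : ℝ)) * (N : ℝ) ^ (1 + max A₁ 0 + max B 0) := by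
          nlinarith



/-! ## (E) The weak rung = existence + a bound for minimal data -/

/-- **(E) Split of the weak rung** (the `∃ A C`-analogue of the route item `MinimalBoundGivesTarget`,
stmt-ABC-3328): `PolyFreyDegree` holds iff every Frey curve carries a datum at its conductor level
(`FreyModularity`, stmt-ABC-11340) AND every MINIMAL-degree datum satisfies `deg D ≤ C N^A` for
absolute `A, C`.  (`→`: a minimal datum is below the datum the item provides; `←`: a minimal datum
exists by well-ordering.)  This isolates exactly where modularity enters the item. [folklore] -/
theorem polyFreyDegree_iff_freyModularity_and_minimalBound :
    PolyFreyDegree ↔ (FreyModularity ∧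
      ∃ A C : ℝ, ∀ a b : ℤ, IsCoprime a b → a * b * (a + b) ≠ 0 → ∀ (N : ℕ) [NeZero N],
        (freyCurve a b).conductorNorm ℤ = N →
        ∀ D : ModularParametrizationData (freyCurve a b) N,
          (∀ D' : ModularParametrizationData (freyCurve a b) N, D.deg ≤ D'.deg) →
            (D.deg : ℝ) ≤ C * (N : ℝ) ^ A) := by
  constructor
  · intro h
    refine ⟨freyModularity_of_polyFreyDegree h, ?_⟩
    obtain ⟨A, C, hAC⟩ := h
    refine ⟨A, C, fun a b hab h0 N _ hN D hmin ↦ ?_⟩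
    obtain ⟨D₀, hD₀⟩ := hAC a b hab h0 N hN
    exact (Nat.cast_le.mpr (hmin D₀)).trans hD₀
  · rintro ⟨hMod, A, C, hAC⟩
    unfold PolyFreyDegree
    refine ⟨A, C, fun a b hab h0 N _ hN ↦ ?_⟩
    obtain ⟨D, hmin⟩ := exists_minimal_datum (hMod a b hab h0 N hN)
    exact ⟨D, hAC a b hab h0 N hN D hmin⟩

/-- **(B) The weak glue.**  `XiBound → DefiniteRTControlPrime → (v_q(Δ_min) ≤ K N^B at odd primes
q ∣ N) → FreyModularity → PolyFreyDegree`: the minimal-data bound (B₀) plus existence, through the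
split (E). [folklore] -/
theorem polyFreyDegree_of_xiBound_of_valuationBound (hXi : XiBound) (hRT : DefiniteRTControlPrime)
    (hval : ∃ B K : ℝ, ∀ a b : ℤ, IsCoprime a b → a * b * (a + b) ≠ 0 → ∀ (N : ℕ) [NeZero N],
      (freyCurve a b).conductorNorm ℤ = N → ∀ q : ℕ, q.Prime → q ≠ 2 → q ∣ N →
        ((((freyCurve a b).minimalDiscriminantNorm ℤ).factorization q : ℕ) : ℝ) ≤ K * (N : ℝ) ^ B)
    (hMod : FreyModularity) : PolyFreyDegree :=
  polyFreyDegree_iff_freyModularity_and_minimalBound.mpr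
    ⟨hMod, minimalDegreeBound_of_xiBound_of_valuationBound hXi hRT hval⟩

/-! ## (D) The weak rung assembled -/

/-- **The GL₂ avatar, assembled.** `XiBound ∧ DefiniteRTControlPrime ∧ FreyModularity ⟹ PolyFreyDegree`,
given Stewart–Tijdeman (`stewartTijdeman1986_upperBound`, a named fact of the barrier catalogue,
not discharged in the tree: linear forms in logarithms). [folklore] -/
theorem polyFreyDegree_of_xiBound
    (hST : Literature.Barriers.ABC.stewartTijdeman1986_upperBound)
    (hXi : XiBound) (hRT : DefiniteRTControlPrime) (hMod : FreyModularity) : PolyFreyDegree :=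
  polyFreyDegree_of_xiBound_of_valuationBound hXi hRT (freyValuationBound_of_stewartTijdeman hST) hMod

/-- The same with Stewart–Yu 2001 (`stewart_yu`, abc.S06: `log c ≪ rad^{1/3} (log rad)³`) as the
transcendence input (`stewartTijdeman1986_of_stewartYu`). [folklore] -/
theorem polyFreyDegree_of_xiBound_of_stewartYu
    (hSY : Literature.NumberTheory.DiophantineGeometry.stewart_yu)
    (hXi : XiBound) (hRT : DefiniteRTControlPrime) (hMod : FreyModularity) : PolyFreyDegree :=
  polyFreyDegree_of_xiBound (Literature.Barriers.ABC.stewartTijdeman1986_of_stewartYu hSY) hXi hRT hMod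

end Summit.ABC.ABC.Theorems.DefiniteXiPolyFreyDegree

end
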